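import Mathlib
import HarnessLib

/-!
# Eisenstein-type root relations force the degree to divide the ramification index

Topic `Literature/NumberTheory/NumberFields`; namespace `Literature.NumberTheory.NumberFields`.
THEOREMS ONLY (no definition, no named fact).

Let `L` be a number field, `Q` a non-zero prime of `𝓞 L` above the rational prime `p`, and
`β₀, …, β_{n-1} ∈ 𝓞 L` (think: the roots, in a Galois number field, of a monic integer polynomial
of degree `n` which is Eisenstein at `p`) such that every `βᵢⁿ` is divisible by `p` and
`∏ βᵢ = p · u` with `u ∉ Q`.  Then `n` divides the ramification index `e(Q | p)`
(`dvd_ramificationIdx_of_pow_mem_of_prod_eq`).  Proof: with `v = v_Q` the `Q`-adic valuation of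
principal ideals (`Multiset.count Q ∘ normalizedFactors ∘ Ideal.span`), `n · v(βᵢ) = v(βᵢⁿ) ≥ v(p) = e`
for every `i` while `Σᵢ v(βᵢ) = v(p u) = e`; summing the inequalities gives equality throughout, so
`n · v(β₀) = e`.  This is the valuation-theoretic core of "an Eisenstein polynomial of degree `n`
at `p` generates a totally ramified extension of degree `n` of `ℚ_p`, so `n ∣ e(Q | p)` in every
number field in which it splits" (Neukirch, *Algebraic Number Theory*, Ch. II (6.2)–(6.3) and
Ch. I §8 Ex. 3; Cassels, *Local Fields*, Ch. 6 §4), stated without local fields.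

## References

* J. Neukirch, *Algebraic Number Theory*, Grundlehren 322 (1999), Ch. I (8.3) and §8 Exercise 3,
  Ch. II (6.2)–(6.3) (Eisenstein polynomials and total ramification). [NeukirchANT1999]
* J. W. S. Cassels, *Local Fields*, LMS Student Texts 3 (1986), Ch. 6 §4. [Cassels1986]
-/

noncomputable section

open NumberField Ideal UniqueFactorizationMonoid

namespace Literature.NumberTheory.NumberFields

variable {L : Type*} [Field L] [NumberField L]

/-- The `Q`-adic valuation of the principal ideal `(x)`, as the multiplicity of `Q` in its
factorisation: additive on products of non-zero elements. [folklore] -/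
theorem count_normalizedFactors_span_mul (Q : Ideal (𝓞 L)) {x y : 𝓞 L} (hx : x ≠ 0)
    (hy : y ≠ 0) :
    Multiset.count Q (normalizedFactors (Ideal.span {x * y})) =
      Multiset.count Q (normalizedFactors (Ideal.span {x})) +
        Multiset.count Q (normalizedFactors (Ideal.span {y})) := by
  classical
  rw [← Ideal.span_singleton_mul_span_singleton,
    normalizedFactors_mul (by simpa using hx) (by simpa using hy), Multiset.count_add]

/-- The `Q`-adic valuation of `(∏ xᵢ)` is the sum of the valuations of the `(xᵢ)`. [folklore] -/
theorem count_normalizedFactors_span_prod (Q : Ideal (𝓞 L)) {ι : Type*} (s : Finset ι)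
    (x : ι → 𝓞 L) :
    (∀ i ∈ s, x i ≠ 0) → Multiset.count Q (normalizedFactors (Ideal.span {∏ i ∈ s, x i})) =
      ∑ i ∈ s, Multiset.count Q (normalizedFactors (Ideal.span {x i})) := by
  classical
  induction s using Finset.induction_on with
  | empty =>
    intro _
    simp [normalizedFactors_one, ← Ideal.one_eq_top, Ideal.span_singleton_one]
  | insert a s ha ih =>
    intro hx
    rw [Finset.prod_insert ha, Finset.sum_insert ha,
      count_normalizedFactors_span_mul Q (hx a (Finset.mem_insert_self a s))
        (Finset.prod_ne_zero_iff.mpr fun i hi => hx i (Finset.mem_insert_of_mem hi)),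
      ih fun i hi => hx i (Finset.mem_insert_of_mem hi)]

/-- The `Q`-adic valuation of `(xⁿ)` is `n` times that of `(x)`. [folklore] -/
theorem count_normalizedFactors_span_pow (Q : Ideal (𝓞 L)) (x : 𝓞 L) (n : ℕ) :
    Multiset.count Q (normalizedFactors (Ideal.span {x ^ n})) =
      n * Multiset.count Q (normalizedFactors (Ideal.span {x})) := by
  classical
  rw [← Ideal.span_singleton_pow, normalizedFactors_pow, Multiset.count_nsmul]

/-- For a prime `Q` and `u ∉ Q`, the `Q`-adic valuation of `(u)` vanishes. [folklore] -/
theorem count_normalizedFactors_span_eq_zero {Q : Ideal (𝓞 L)} [Q.IsPrime] {u : 𝓞 L}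
    (hu : u ∉ Q) : Multiset.count Q (normalizedFactors (Ideal.span {u})) = 0 := by
  classical
  rw [Multiset.count_eq_zero]
  intro hmem
  exact hu (Ideal.dvd_span_singleton.mp (dvd_of_mem_normalizedFactors hmem))

/-- **Eisenstein-type root relations force `n ∣ e(Q | p)`.**  Let `Q` be a prime of `𝓞 L`
containing the rational prime `p`, and `β : Fin n → 𝓞 L` with `p ∣ βᵢⁿ` for all `i` and
`∏ βᵢ = p · u`, `u ∉ Q`.  Then `n` divides the ramification index of `Q` over `p`.  (For the `n`
roots of a degree-`n` Eisenstein polynomial at `p`: `βⁿ = -(a_{n-1}βⁿ⁻¹ + ⋯ + a₀)` with `p ∣ aᵢ`,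
and `∏ βᵢ = ± a₀ = p · u` with `p ∤ u`.)
[cite: NeukirchANT1999, Ch. II (6.2)–(6.3) and Ch. I §8 Exercise 3] -/
theorem dvd_ramificationIdx_of_pow_mem_of_prod_eq {Q : Ideal (𝓞 L)} [Q.IsPrime]
    {p : ℕ} (hp : p.Prime) (hpQ : (p : 𝓞 L) ∈ Q) {n : ℕ} (β : Fin n → 𝓞 L)
    (hpow : ∀ i, ∃ c : 𝓞 L, β i ^ n = p * c) {u : 𝓞 L} (hu : u ∉ Q)
    (hprod : ∏ i, β i = p * u) :
    n ∣ Q.ramificationIdx ℤ := by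
  classical
  -- `Q` lies over `(p) ⊆ ℤ`
  haveI hover : Q.LiesOver (Ideal.span {(p : ℤ)}) := by
    refine ⟨?_⟩
    have hprime : (Ideal.span {(p : ℤ)}).IsPrime :=
      (Ideal.span_singleton_prime (by exact_mod_cast hp.ne_zero)).mpr
        (Nat.prime_iff_prime_int.mp hp)
    have hmax : (Ideal.span {(p : ℤ)}).IsMaximal := hprime.isMaximal (by simp [hp.ne_zero])
    refine hmax.eq_of_le (Ideal.IsPrime.ne_top inferInstance) ?_
    rw [Ideal.span_le, Set.singleton_subset_iff, SetLike.mem_coe, Ideal.under_def, Ideal.mem_comap,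
      map_natCast]
    exact hpQ
  -- notation: `v x = v_Q((x))`
  set v : 𝓞 L → ℕ := fun x => Multiset.count Q (normalizedFactors (Ideal.span {x})) with hv
  have hp0 : (p : 𝓞 L) ≠ 0 := by exact_mod_cast hp.ne_zero
  have hu0 : u ≠ 0 := fun h => hu (h ▸ Q.zero_mem)
  have hβ0 : ∀ i, β i ≠ 0 := by
    intro i h0
    have : (p : 𝓞 L) * u = 0 := by
      rw [← hprod]
      exact Finset.prod_eq_zero (Finset.mem_univ i) h0
    rcases mul_eq_zero.mp this with h | h
    · exact hp0 h
    · exact hu0 h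
  -- `e = v p`
  have hmap : Ideal.map (algebraMap ℤ (𝓞 L)) (Ideal.span {(p : ℤ)}) = Ideal.span {(p : 𝓞 L)} := by
    rw [Ideal.map_span, Set.image_singleton, map_natCast]
  have he : Q.ramificationIdx ℤ = v p := by
    rw [Ideal.IsDedekindDomain.ramificationIdx_eq_normalizedFactors_count (Ideal.span {(p : ℤ)}) Q
      (by rw [hmap]; simpa using hp0), hmap]
  rw [he]
  -- `n * v (β i) ≥ v p` for every `i`
  have hge : ∀ i, v p ≤ n * v (β i) := by
    intro i
    obtain ⟨c, hc⟩ := hpow i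
    have hc0 : c ≠ 0 := by
      intro h0
      rw [h0, mul_zero] at hc
      exact pow_ne_zero n (hβ0 i) hc
    have := count_normalizedFactors_span_mul Q hp0 hc0
    rw [← hc, count_normalizedFactors_span_pow Q (β i)] at this
    change n * v (β i) = v p + v c at this
    omega
  -- `Σ v (β i) = v p`
  have hsum : ∑ i, v (β i) = v p := by
    have h1 := count_normalizedFactors_span_prod Q Finset.univ β fun i _ => hβ0 i
    rw [hprod, count_normalizedFactors_span_mul Q hp0 hu0, count_normalizedFactors_span_eq_zero hu,
      add_zero] at h1
    exact h1.symm
  -- summing the inequalities: equality everywhere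
  rcases Nat.eq_zero_or_pos n with hn | hn
  · subst hn
    simp only [Finset.univ_eq_empty, Finset.sum_empty] at hsum
    rw [← hsum]
  · have key : ∀ i, n * v (β i) = v p := by
      have htot : ∑ i : Fin n, n * v (β i) = n * v p := by
        rw [← Finset.mul_sum, hsum]
      have hle : ∑ _i : Fin n, v p ≤ ∑ i : Fin n, n * v (β i) :=
        Finset.sum_le_sum fun i _ => hge i
      rw [Finset.sum_const, Finset.card_univ, Fintype.card_fin, smul_eq_mul] at hle
      -- `n * v p ≤ Σ n v(βᵢ) = n * v p`, so every summand inequality is an equality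
      intro i
      by_contra hne
      have hlt : v p < n * v (β i) := lt_of_le_of_ne (hge i) (Ne.symm hne)
      have : ∑ _j : Fin n, v p < ∑ j : Fin n, n * v (β j) :=
        Finset.sum_lt_sum (fun j _ => hge j) ⟨i, Finset.mem_univ i, hlt⟩
      rw [Finset.sum_const, Finset.card_univ, Fintype.card_fin, smul_eq_mul, htot] at this
      exact lt_irrefl _ this
    exact ⟨v (β ⟨0, hn⟩), (key ⟨0, hn⟩).symm⟩

end Literature.NumberTheory.NumberFields

end
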